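import Summits.RiemannHypothesis.RiemannHypothesis.Theses.RuelleBand
import Literature.NumberTheory.LFunctions.GeneralizedRH

/-!
# `CofiniteCriticalLine` (crux stmt-RiemannHypothesis-2064) — why it resists disproof; reformulations

The crux of route RuelleBand, rank 5, is
`CofiniteCriticalLine := {s : ℂ | riemannZeta s = 0 ∧ 0 < s.re ∧ s.re < 1 ∧ s.re ≠ 1 / 2}.Finite`.
Refuter's standing-adversary output (cdisprove cycle 1), kernel-checked, statements inline:

* `not_riemannHypothesis_of_not_cofiniteCriticalLine` — a disproof of the crux is a disproof of RH
  (under RH the exceptional set is empty): no counterexample search can succeed short of `¬RH`.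
* `cofiniteCriticalLine_iff_diff_finite` — deleting any finite set of (computed) off-line zeros does not change
  the truth value: the crux is not refutable by any finite computation.
* `cofiniteCriticalLine_iff_eventually_on_line` — crux ⟺ "every zero in the strip above some height `T` is on
  the line" (finitely many exceptions ⟺ exceptions of bounded height, by discreteness of the zeros).
* `cofiniteCriticalLine_iff_rh_or` — crux ⟺ RH ∨ (finitely many and at least one exception): the standing
  hypothesis of Bombieri 2000, Thms 10–11.
* Symmetric forms: crux ⟺ finitely many zeros with `1/2 < re s < 1` (FIN of idea card
  zero-or-infinity-offline) ⟺ with `0 < re s < 1/2` ⟺ in the open quadrant `1/2 < re s < 1, im s > 0`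
  (functional equation `s ↦ 1 - s`, conjugation `s ↦ conj s`).
-/

noncomputable section

open Complex Set
open scoped ComplexConjugate

namespace Summit.RiemannHypothesis.Cruxes.CofiniteCriticalLine.Negative

open Summit.RiemannHypothesis.RiemannHypothesis.Theses.RuelleBand
open Literature.NumberTheory.LFunctions

/-- A point of the open right half-plane is not a trivial zero `-2(n+1)`. [folklore] -/
theorem not_trivialZero_of_re_pos {s : ℂ} (h0 : 0 < s.re) : ¬ ∃ n : ℕ, s = -2 * (n + 1) := by
  rintro ⟨n, hn⟩
  have hre := congrArg Complex.re hn
  rw [show (-2 * ((n : ℂ) + 1)) = ((-2 * ((n : ℝ) + 1) : ℝ) : ℂ) by push_cast; ring, ofReal_re] at hre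
  have : (0 : ℝ) ≤ n := n.cast_nonneg
  linarith

/-- Under RH the exceptional set of the crux is empty. [folklore] -/
theorem offLine_eq_empty_of_riemannHypothesis (h : RiemannHypothesis) :
    {s : ℂ | riemannZeta s = 0 ∧ 0 < s.re ∧ s.re < 1 ∧ s.re ≠ 1 / 2} = ∅ := by
  refine Set.subset_empty_iff.1 fun s hs => ?_
  obtain ⟨hz, h0, h1, hne⟩ := hs
  refine absurd (h s hz (not_trivialZero_of_re_pos h0) ?_) hne
  rintro rfl
  norm_num at h1

/-- WHY IT RESISTS: a disproof of the crux is a disproof of the Riemann Hypothesis (under RH the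
exceptional set is empty, hence finite). [folklore] -/
theorem not_riemannHypothesis_of_not_cofiniteCriticalLine (h : ¬ CofiniteCriticalLine) :
    ¬ RiemannHypothesis := by
  intro hRH
  apply h
  show {s : ℂ | riemannZeta s = 0 ∧ 0 < s.re ∧ s.re < 1 ∧ s.re ≠ 1 / 2}.Finite
  rw [offLine_eq_empty_of_riemannHypothesis hRH]
  exact Set.finite_empty

/-- RH is exactly "the exceptional set of the crux is empty" (zeros with `re s ≤ 0` are trivial:
tree fact `riemannHypothesis_iff_strip_holds`, proved). [folklore] -/
theorem riemannHypothesis_iff_offLine_eq_empty :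
    RiemannHypothesis ↔ {s : ℂ | riemannZeta s = 0 ∧ 0 < s.re ∧ s.re < 1 ∧ s.re ≠ 1 / 2} = ∅ := by
  refine ⟨offLine_eq_empty_of_riemannHypothesis, fun h => ?_⟩
  rw [show RiemannHypothesis ↔ RiemannHypothesisStrip from riemannHypothesis_iff_strip_holds]
  intro s hz h0 h1
  by_contra hne
  have hs : s ∈ {s : ℂ | riemannZeta s = 0 ∧ 0 < s.re ∧ s.re < 1 ∧ s.re ≠ 1 / 2} := ⟨hz, h0, h1, hne⟩
  rw [h] at hs
  exact hs

/-- The crux is "RH, or finitely many but at least one exception" — the standing hypothesis of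
Bombieri's Theorems 10–11, under which consequences are derived without contradiction.
[cite: Bombieri2000Weil, Thms 10–11] -/
theorem cofiniteCriticalLine_iff_rh_or :
    CofiniteCriticalLine ↔ RiemannHypothesis ∨
      ({s : ℂ | riemannZeta s = 0 ∧ 0 < s.re ∧ s.re < 1 ∧ s.re ≠ 1 / 2}.Finite ∧
        {s : ℂ | riemannZeta s = 0 ∧ 0 < s.re ∧ s.re < 1 ∧ s.re ≠ 1 / 2}.Nonempty) := by
  rw [riemannHypothesis_iff_offLine_eq_empty]
  constructor
  · intro h
    rcases Set.eq_empty_or_nonempty {s : ℂ | riemannZeta s = 0 ∧ 0 < s.re ∧ s.re < 1 ∧ s.re ≠ 1 / 2}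
      with he | hne
    · exact Or.inl he
    · exact Or.inr ⟨h, hne⟩
  · rintro (he | ⟨h, -⟩)
    · show {s : ℂ | riemannZeta s = 0 ∧ 0 < s.re ∧ s.re < 1 ∧ s.re ≠ 1 / 2}.Finite
      rw [he]; exact Set.finite_empty
    · exact h

/-- NOT FINITELY REFUTABLE: deleting any finite set `E` (e.g. a finite list of computed off-line zeros) from
the exceptional set does not change the truth value of the crux; a kill must exhibit an infinite family of
off-line zeros. [folklore] -/
theorem cofiniteCriticalLine_iff_diff_finite {E : Set ℂ} (hE : E.Finite) :
    CofiniteCriticalLine ↔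
      ({s : ℂ | riemannZeta s = 0 ∧ 0 < s.re ∧ s.re < 1 ∧ s.re ≠ 1 / 2} \ E).Finite := by
  refine ⟨fun h => Set.Finite.subset h fun _ hx => hx.1, fun h => (h.union hE).subset ?_⟩
  intro s hs
  by_cases h' : s ∈ E
  · exact Or.inr h'
  · exact Or.inl ⟨hs, h'⟩

/-- Crux ⟺ "RH holds above some height": finitely many exceptions ⟺ exceptions of bounded height (the zeros
of `ζ` in a compact set are finitely many, Mathlib `IsCompact.inter_riemannZetaZeros_finite`). [folklore] -/
theorem cofiniteCriticalLine_iff_eventually_on_line :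
    CofiniteCriticalLine ↔
      ∃ T : ℝ, ∀ s : ℂ, riemannZeta s = 0 → 0 < s.re → s.re < 1 → T < |s.im| → s.re = 1 / 2 := by
  constructor
  · intro h
    obtain ⟨T, hT⟩ := (Set.Finite.image (fun s : ℂ => |s.im|) h).bddAbove
    refine ⟨T, fun s hz h0 h1 hT' => ?_⟩
    by_contra hne
    have : |s.im| ≤ T := hT ⟨s, ⟨hz, h0, h1, hne⟩, rfl⟩
    linarith
  · rintro ⟨T, hT⟩
    refine (((isCompact_Icc (a := (0 : ℝ)) (b := 1)).reProdIm
      (isCompact_Icc (a := -T) (b := T))).inter_riemannZetaZeros_finite).subset ?_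
    rintro s ⟨hz, h0, h1, hne⟩
    have him : |s.im| ≤ T := not_lt.1 fun h => hne (hT s hz h0 h1 h)
    exact ⟨Complex.mem_reProdIm.2 ⟨⟨h0.le, h1.le⟩, abs_le.1 him⟩, hz⟩

/-! ## Symmetric forms -/

/-- A zero with `0 < re s < 1/2` reflects to a zero with `1/2 < re (1 - s) < 1` (functional equation,
tree lemma `GeneralizedRH.riemannZeta_one_sub_eq_zero` over Mathlib `riemannZeta_one_sub`). [folklore] -/
theorem one_sub_mem_rightHalf {s : ℂ} (hs : s ∈ {s : ℂ | riemannZeta s = 0 ∧ 0 < s.re ∧ s.re < 1 / 2}) :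
    1 - s ∈ {s : ℂ | riemannZeta s = 0 ∧ 1 / 2 < s.re ∧ s.re < 1} := by
  obtain ⟨hz, h0, h⟩ := hs
  refine ⟨GeneralizedRH.riemannZeta_one_sub_eq_zero hz h0 (by linarith), ?_, ?_⟩
  · simp only [sub_re, one_re]; linarith
  · simp only [sub_re, one_re]; linarith

/-- A zero with `1/2 < re s < 1` reflects to a zero with `0 < re (1 - s) < 1/2`. [folklore] -/
theorem one_sub_mem_leftHalf {s : ℂ} (hs : s ∈ {s : ℂ | riemannZeta s = 0 ∧ 1 / 2 < s.re ∧ s.re < 1}) :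
    1 - s ∈ {s : ℂ | riemannZeta s = 0 ∧ 0 < s.re ∧ s.re < 1 / 2} := by
  obtain ⟨hz, h, h1⟩ := hs
  refine ⟨GeneralizedRH.riemannZeta_one_sub_eq_zero hz (by linarith) h1, ?_, ?_⟩
  · simp only [sub_re, one_re]; linarith
  · simp only [sub_re, one_re]; linarith

/-- The exceptional set is the union of its two halves. [folklore] -/
theorem offLine_eq_union :
    {s : ℂ | riemannZeta s = 0 ∧ 0 < s.re ∧ s.re < 1 ∧ s.re ≠ 1 / 2} =
      {s : ℂ | riemannZeta s = 0 ∧ 0 < s.re ∧ s.re < 1 / 2} ∪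
        {s : ℂ | riemannZeta s = 0 ∧ 1 / 2 < s.re ∧ s.re < 1} := by
  ext s
  simp only [mem_setOf_eq, mem_union]
  constructor
  · rintro ⟨hz, h0, h1, hne⟩
    rcases lt_or_gt_of_ne hne with h | h
    · exact Or.inl ⟨hz, h0, h⟩
    · exact Or.inr ⟨hz, h, h1⟩
  · rintro (⟨hz, h0, h⟩ | ⟨hz, h, h1⟩)
    · exact ⟨hz, h0, by linarith, h.ne⟩
    · exact ⟨hz, by linarith, h1, h.ne'⟩

/-- Crux ⟺ FIN: finitely many zeros with `1/2 < re s < 1` (idea card zero-or-infinity-offline). [folklore] -/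
theorem cofiniteCriticalLine_iff_rightHalf_finite :
    CofiniteCriticalLine ↔ {s : ℂ | riemannZeta s = 0 ∧ 1 / 2 < s.re ∧ s.re < 1}.Finite := by
  show {s : ℂ | riemannZeta s = 0 ∧ 0 < s.re ∧ s.re < 1 ∧ s.re ≠ 1 / 2}.Finite ↔ _
  rw [offLine_eq_union]
  refine ⟨fun h => h.subset subset_union_right, fun h => Set.Finite.union ?_ h⟩
  refine (h.image fun s : ℂ => 1 - s).subset fun s hs => ?_
  exact ⟨1 - s, one_sub_mem_rightHalf hs, sub_sub_cancel 1 s⟩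

/-- Crux ⟺ finitely many zeros with `0 < re s < 1/2`. [folklore] -/
theorem cofiniteCriticalLine_iff_leftHalf_finite :
    CofiniteCriticalLine ↔ {s : ℂ | riemannZeta s = 0 ∧ 0 < s.re ∧ s.re < 1 / 2}.Finite := by
  show {s : ℂ | riemannZeta s = 0 ∧ 0 < s.re ∧ s.re < 1 ∧ s.re ≠ 1 / 2}.Finite ↔ _
  rw [offLine_eq_union]
  refine ⟨fun h => h.subset subset_union_left, fun h => Set.Finite.union h ?_⟩
  refine (h.image fun s : ℂ => 1 - s).subset fun s hs => ?_
  exact ⟨1 - s, one_sub_mem_leftHalf hs, sub_sub_cancel 1 s⟩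

/-- Crux ⟺ finitely many zeros in the open quadrant `1/2 < re s < 1`, `im s > 0` (conjugation symmetry,
Mathlib `riemannZeta_conj`; non-trivial zeros are non-real, `ZetaRealAxis`). [folklore] -/
theorem cofiniteCriticalLine_iff_quadrant_finite :
    CofiniteCriticalLine ↔ {s : ℂ | riemannZeta s = 0 ∧ 1 / 2 < s.re ∧ s.re < 1 ∧ 0 < s.im}.Finite := by
  rw [cofiniteCriticalLine_iff_rightHalf_finite]
  refine ⟨fun h => h.subset ?_, fun h => ?_⟩
  · rintro s ⟨hz, h, h1, -⟩
    exact ⟨hz, h, h1⟩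
  · refine (h.union (h.image fun s : ℂ => conj s)).subset ?_
    rintro s ⟨hz, h, h1⟩
    have him : s.im ≠ 0 := im_ne_zero_of_riemannZeta_eq_zero hz (by linarith) h1
    rcases lt_or_gt_of_ne him with hneg | hpos
    · refine Or.inr ⟨conj s, ⟨?_, ?_, ?_, ?_⟩, by simp⟩
      · rw [riemannZeta_conj, hz, map_zero]
      · simpa using h
      · simpa using h1
      · rw [conj_im]; linarith
    · exact Or.inl ⟨hz, h, h1, hpos⟩

end Summit.RiemannHypothesis.Cruxes.CofiniteCriticalLine.Negative

end
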